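import Summits.Ventures.LatticeQCDFlow.Exactness.PTBCSwapSignRule

/-!
HONEST FRAMING: exact (Metropolis-corrected) sampling algorithms for lattice gauge theory; figures
of merit are autocorrelation/cost numbers at stated couplings and volumes; no continuum-physics
claim.

# PTBCSwapSignRuleVariance — THE SIGN-RULE TRIPWIRE `T = min(1,e^{−ΔS}) − 𝟙[ΔS ≤ 0] − 𝟙[ΔS < 0]` HAS
# EQUILIBRIUM SECOND MOMENT `E T² = P(ΔS < 0) + E[e^{ΔS}; ΔS < 0]`, HENCE `P(ΔS < 0) ≤ E T² ≤ 2P(ΔS < 0) ≤ ⟨acc⟩`: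
# ITS SINGLE-PROPOSAL VARIANCE IS AT MOST THE MEAN SWAP ACCEPTANCE ITSELF (row 22 `su3-ptbc`, GEN-8, ours;
# sequel of GEN-5's `PTBCSwapSignRule`, whose bound was `T² ≤ 1`)

Venture `LatticeQCDFlow` (cell pub-lqcd), topic `Exactness`; FANOUT row 22 (`su3-ptbc`, PTBC comparator arm
E4).  NEW WORK of the cell over GEN-5's `Exactness/PTBCSwapSignRule` (two replica slots with measurable actions
`S₁, S₂` over an s-finite reference measure `vol`, joint weight `e^{−E}`, `E = pairEnergy S₁ S₂`, swap energy
`ΔS = swapDelta S₁ S₂`; `swap_fluctuation_relation` — `∫ g(ΔS)e^{−E} = ∫ g(−ΔS)e^{−ΔS}e^{−E}` for every `g`;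
`swap_acceptance_sign_rule` — `∫ min(1,e^{−ΔS})e^{−E} = ∫ 𝟙[ΔS ≤ 0]e^{−E} + ∫ 𝟙[ΔS < 0]e^{−E}`; `signRuleStat`,
`swap_signRuleStat_integral_eq_zero` — `E T = 0`) and row 2's `integrable_bdd_mul_weight`.  Nothing is cited
as a fact; no numerics.

## What is proved

* `signRuleStat_sq_eq` — pointwise `T(d)² = 𝟙[d < 0] + 𝟙[0 < d]·e^{−2d}`.
* `swap_uphill_sq_integral_eq` — `∫ 𝟙[ΔS > 0]e^{−2ΔS}e^{−E} = ∫ 𝟙[ΔS < 0]e^{ΔS}e^{−E}` (the fluctuation relation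
  with `g(u) = 𝟙[u > 0]e^{−2u}`: the squared uphill Metropolis factor is the downhill mass tilted by `e^{ΔS} < 1`).
* **`swap_signRuleStat_sq_integral_eq`** — `∫ T(ΔS)² e^{−E} = ∫ 𝟙[ΔS < 0]e^{−E} + ∫ 𝟙[ΔS < 0]e^{ΔS}e^{−E}`.
* **`swap_signRuleStat_sq_integral_le_two_mul`**, **`swap_signRuleStat_sq_integral_le_acceptance`**,
  `le_swap_signRuleStat_sq_integral` — `∫ 𝟙[ΔS<0]e^{−E} ≤ ∫ T²e^{−E} ≤ 2∫ 𝟙[ΔS<0]e^{−E} ≤ ∫ min(1,e^{−ΔS})e^{−E}`;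
  normalised under the joint Boltzmann law `π = e^{−E}(vol⊗vol)/Z` (`Z > 0`):
  **`swap_signRuleStat_sq_boltzmann_le_acceptance`** — `∫ T² dπ ≤ ∫ min(1, e^{−ΔS}) dπ`; with `∫ T dπ = 0`
  (GEN-5) the single-proposal VARIANCE of the sign-rule tripwire is at most the mean swap acceptance.

Reading for CARD-su3-ptbc §3 / §14 (protocol note, markdown arithmetic, no number of ours): inside the card's
`20 ± 5 %` band the sign-rule statistic has `Var T ≤ ⟨acc⟩ ≤ 1/4` per proposal (GEN-5: `≤ 1`), so its naive
`3σ` resolution after `n` effectively independent proposals of a pair is `≤ 3/(2√n)`: `±0.1` needs `n ≈ 225`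
(GEN-5's bound said `900`), `±0.02` needs `n ≈ 5 600`; the `⟨e^{−ΔS}⟩ = 1` monitor needs `> 5·10⁵` for `±0.1`
at the same acceptance (`PTBCSwapSignRule.swapMonitor_sqDev_gt`).  Literature grade (cell rule): KNOWN
MECHANISM (fluctuation relation for an involutive, measure-preserving proposal; Creutz 1988,
Gupta–Irbäck–Karsch–Petersson 1990), NEW TYPING (the second moment of the sign-rule statistic in closed form
and its acceptance bound).  NOT CLAIMED: autocorrelation between successive proposals (the `n` above is an
effective count); the Gaussian-model value `Φ(−σ/2) + e^{σ²}Φ(−3σ/2)` of `E T²` (not needed); any number of a run.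
-/

noncomputable section

namespace Summit.Ventures.LatticeQCDFlow.Exactness

open MeasureTheory Real
open Literature.Probability.MarkovChains

variable {Ω : Type*} [MeasurableSpace Ω]

omit [MeasurableSpace Ω] in
/-- **`T(d)² = 𝟙[d < 0] + 𝟙[0 < d]·e^{−2d}`**: downhill the statistic is `−1`, at `d = 0` it is `0`, uphill it
is the Metropolis factor `e^{−d}`. [ours] -/
theorem signRuleStat_sq_eq (d : ℝ) :
    signRuleStat d ^ 2 = (if d < 0 then (1 : ℝ) else 0) + (if 0 < d then (1 : ℝ) else 0) * exp (-(2 * d)) := by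
  unfold signRuleStat
  rcases lt_trichotomy d 0 with hd | rfl | hd
  · have h1 : (1 : ℝ) ≤ exp (-d) := by rw [← exp_zero]; exact exp_le_exp.mpr (by linarith)
    rw [min_eq_left h1, if_pos hd.le, if_pos hd, if_neg (not_lt.mpr hd.le)]
    norm_num
  · simp
  · have h1 : exp (-d) ≤ 1 := by rw [← exp_zero]; exact exp_le_exp.mpr (by linarith)
    rw [min_eq_right h1, if_neg (not_le.mpr hd), if_neg (not_lt.mpr hd.le), if_pos hd,
      show -(2 * d) = -d + -d by ring, exp_add]
    ring

omit [MeasurableSpace Ω] in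
/-- `0 ≤ 𝟙[0 < d]·e^{−2d} ≤ 1`. [folklore] -/
theorem uphill_sq_mem (d : ℝ) :
    0 ≤ (if 0 < d then (1 : ℝ) else 0) * exp (-(2 * d)) ∧ (if 0 < d then (1 : ℝ) else 0) * exp (-(2 * d)) ≤ 1 := by
  by_cases hd : 0 < d
  · rw [if_pos hd, one_mul]
    refine ⟨(exp_pos _).le, ?_⟩
    rw [← exp_zero]
    exact exp_le_exp.mpr (by linarith)
  · rw [if_neg hd, zero_mul]
    exact ⟨le_rfl, zero_le_one⟩

variable (vol : Measure Ω) [SFinite vol] {S₁ S₂ : Ω → ℝ}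

/-- `ΔS` is measurable. [folklore] -/
theorem measurable_swapDelta (h₁ : Measurable S₁) (h₂ : Measurable S₂) : Measurable (swapDelta S₁ S₂) :=
  (((h₁.comp measurable_snd).add (h₂.comp measurable_fst)).sub (h₁.comp measurable_fst)).sub
    (h₂.comp measurable_snd)

/-- **`∫ 𝟙[ΔS > 0]e^{−2ΔS}e^{−E} = ∫ 𝟙[ΔS < 0]e^{ΔS}e^{−E}`** — the fluctuation relation of the swap with
`g(u) = 𝟙[u > 0]e^{−2u}`. [ours] -/
theorem swap_uphill_sq_integral_eq :
    ∫ z, (if 0 < swapDelta S₁ S₂ z then (1 : ℝ) else 0) * exp (-(2 * swapDelta S₁ S₂ z))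
        * exp (-pairEnergy S₁ S₂ z) ∂(vol.prod vol)
      = ∫ z, (if swapDelta S₁ S₂ z < 0 then (1 : ℝ) else 0) * exp (swapDelta S₁ S₂ z)
        * exp (-pairEnergy S₁ S₂ z) ∂(vol.prod vol) := by
  have h := swap_fluctuation_relation vol (S₁ := S₁) (S₂ := S₂)
    (fun u => (if 0 < u then (1 : ℝ) else 0) * exp (-(2 * u)))
  beta_reduce at h
  rw [h]
  refine integral_congr_ae (ae_of_all _ fun z => ?_)
  beta_reduce
  by_cases hz : swapDelta S₁ S₂ z < 0
  · rw [if_pos (neg_pos.mpr hz), if_pos hz, one_mul, one_mul, ← exp_add, ← exp_add, ← exp_add]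
    congr 1
    ring
  · rw [if_neg (fun h' => hz (neg_pos.mp h')), if_neg hz, zero_mul, zero_mul, zero_mul, zero_mul, zero_mul]

/-- **THE SECOND MOMENT OF THE SIGN-RULE STATISTIC**:
`∫ T(ΔS)² e^{−E} = ∫ 𝟙[ΔS < 0]e^{−E} + ∫ 𝟙[ΔS < 0]e^{ΔS}e^{−E}` (`e^{−E}` integrable). [ours] -/
theorem swap_signRuleStat_sq_integral_eq (h₁ : Measurable S₁) (h₂ : Measurable S₂)
    (hint : Integrable (fun z => exp (-pairEnergy S₁ S₂ z)) (vol.prod vol)) :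
    ∫ z, signRuleStat (swapDelta S₁ S₂ z) ^ 2 * exp (-pairEnergy S₁ S₂ z) ∂(vol.prod vol)
      = (∫ z, (if swapDelta S₁ S₂ z < 0 then (1 : ℝ) else 0) * exp (-pairEnergy S₁ S₂ z) ∂(vol.prod vol))
        + ∫ z, (if swapDelta S₁ S₂ z < 0 then (1 : ℝ) else 0) * exp (swapDelta S₁ S₂ z)
            * exp (-pairEnergy S₁ S₂ z) ∂(vol.prod vol) := by
  have hΔ := measurable_swapDelta h₁ h₂
  have hwm : Measurable fun z : Ω × Ω => exp (-pairEnergy S₁ S₂ z) :=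
    measurable_exp.comp (measurable_pairEnergy h₁ h₂).neg
  have hw0 : ∀ z : Ω × Ω, 0 ≤ exp (-pairEnergy S₁ S₂ z) := fun z => (exp_pos _).le
  have hlt_m : Measurable fun z : Ω × Ω => if swapDelta S₁ S₂ z < 0 then (1 : ℝ) else 0 :=
    Measurable.ite (measurableSet_lt hΔ measurable_const) measurable_const measurable_const
  have hup_m : Measurable fun z : Ω × Ω =>
      (if 0 < swapDelta S₁ S₂ z then (1 : ℝ) else 0) * exp (-(2 * swapDelta S₁ S₂ z)) :=
    (Measurable.ite (measurableSet_lt measurable_const hΔ) measurable_const measurable_const).mul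
      (measurable_exp.comp (measurable_const.mul hΔ).neg)
  have hI1 : Integrable (fun z => (if swapDelta S₁ S₂ z < 0 then (1 : ℝ) else 0) * exp (-pairEnergy S₁ S₂ z))
      (vol.prod vol) := by
    refine integrable_bdd_mul_weight hlt_m (C := 1) (fun z => ?_) hwm hw0 hint
    split_ifs <;> simp
  have hI2 : Integrable (fun z => (if 0 < swapDelta S₁ S₂ z then (1 : ℝ) else 0) * exp (-(2 * swapDelta S₁ S₂ z))
      * exp (-pairEnergy S₁ S₂ z)) (vol.prod vol) := by
    refine integrable_bdd_mul_weight hup_m (C := 1) (fun z => ?_) hwm hw0 hint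
    rw [abs_of_nonneg (uphill_sq_mem _).1]
    exact (uphill_sq_mem _).2
  have hsplit : ∀ z : Ω × Ω, signRuleStat (swapDelta S₁ S₂ z) ^ 2 * exp (-pairEnergy S₁ S₂ z)
      = (if swapDelta S₁ S₂ z < 0 then (1 : ℝ) else 0) * exp (-pairEnergy S₁ S₂ z)
        + (if 0 < swapDelta S₁ S₂ z then (1 : ℝ) else 0) * exp (-(2 * swapDelta S₁ S₂ z))
            * exp (-pairEnergy S₁ S₂ z) := by
    intro z; rw [signRuleStat_sq_eq]; ring
  simp_rw [hsplit]
  rw [integral_add hI1 hI2, swap_uphill_sq_integral_eq vol]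

omit [SFinite vol] in
/-- `∫ 𝟙[ΔS < 0]e^{ΔS}e^{−E} ≤ ∫ 𝟙[ΔS < 0]e^{−E}` (`e^{ΔS} < 1` downhill). [ours] -/
theorem swap_downhill_tilted_integral_le (h₁ : Measurable S₁) (h₂ : Measurable S₂)
    (hint : Integrable (fun z => exp (-pairEnergy S₁ S₂ z)) (vol.prod vol)) :
    ∫ z, (if swapDelta S₁ S₂ z < 0 then (1 : ℝ) else 0) * exp (swapDelta S₁ S₂ z)
        * exp (-pairEnergy S₁ S₂ z) ∂(vol.prod vol)
      ≤ ∫ z, (if swapDelta S₁ S₂ z < 0 then (1 : ℝ) else 0) * exp (-pairEnergy S₁ S₂ z) ∂(vol.prod vol) := by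
  have hΔ := measurable_swapDelta h₁ h₂
  have hwm : Measurable fun z : Ω × Ω => exp (-pairEnergy S₁ S₂ z) :=
    measurable_exp.comp (measurable_pairEnergy h₁ h₂).neg
  have hw0 : ∀ z : Ω × Ω, 0 ≤ exp (-pairEnergy S₁ S₂ z) := fun z => (exp_pos _).le
  have hlt_m : Measurable fun z : Ω × Ω => if swapDelta S₁ S₂ z < 0 then (1 : ℝ) else 0 :=
    Measurable.ite (measurableSet_lt hΔ measurable_const) measurable_const measurable_const
  have hmem : ∀ z : Ω × Ω, 0 ≤ (if swapDelta S₁ S₂ z < 0 then (1 : ℝ) else 0) * exp (swapDelta S₁ S₂ z) ∧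
      (if swapDelta S₁ S₂ z < 0 then (1 : ℝ) else 0) * exp (swapDelta S₁ S₂ z)
        ≤ (if swapDelta S₁ S₂ z < 0 then (1 : ℝ) else 0) := by
    intro z
    by_cases hz : swapDelta S₁ S₂ z < 0
    · rw [if_pos hz, one_mul]
      refine ⟨(exp_pos _).le, ?_⟩
      rw [← exp_zero]
      exact exp_le_exp.mpr hz.le
    · rw [if_neg hz, zero_mul]
      exact ⟨le_rfl, le_rfl⟩
  have hI1 : Integrable (fun z => (if swapDelta S₁ S₂ z < 0 then (1 : ℝ) else 0) * exp (-pairEnergy S₁ S₂ z))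
      (vol.prod vol) := by
    refine integrable_bdd_mul_weight hlt_m (C := 1) (fun z => ?_) hwm hw0 hint
    split_ifs <;> simp
  have hI3 : Integrable (fun z => (if swapDelta S₁ S₂ z < 0 then (1 : ℝ) else 0) * exp (swapDelta S₁ S₂ z)
      * exp (-pairEnergy S₁ S₂ z)) (vol.prod vol) := by
    refine integrable_bdd_mul_weight (hlt_m.mul (measurable_exp.comp hΔ)) (C := 1) (fun z => ?_) hwm hw0 hint
    rw [abs_of_nonneg (hmem z).1]
    refine (hmem z).2.trans ?_
    split_ifs <;> simp
  exact integral_mono hI3 hI1 fun z => mul_le_mul_of_nonneg_right (hmem z).2 (hw0 z)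

/-- **`∫ 𝟙[ΔS < 0]e^{−E} ≤ ∫ T² e^{−E} ≤ 2∫ 𝟙[ΔS < 0]e^{−E}`**. [ours] -/
theorem swap_signRuleStat_sq_integral_le_two_mul (h₁ : Measurable S₁) (h₂ : Measurable S₂)
    (hint : Integrable (fun z => exp (-pairEnergy S₁ S₂ z)) (vol.prod vol)) :
    (∫ z, (if swapDelta S₁ S₂ z < 0 then (1 : ℝ) else 0) * exp (-pairEnergy S₁ S₂ z) ∂(vol.prod vol))
        ≤ ∫ z, signRuleStat (swapDelta S₁ S₂ z) ^ 2 * exp (-pairEnergy S₁ S₂ z) ∂(vol.prod vol) ∧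
      ∫ z, signRuleStat (swapDelta S₁ S₂ z) ^ 2 * exp (-pairEnergy S₁ S₂ z) ∂(vol.prod vol)
        ≤ 2 * ∫ z, (if swapDelta S₁ S₂ z < 0 then (1 : ℝ) else 0) * exp (-pairEnergy S₁ S₂ z)
            ∂(vol.prod vol) := by
  rw [swap_signRuleStat_sq_integral_eq vol h₁ h₂ hint]
  have hnn : 0 ≤ ∫ z, (if swapDelta S₁ S₂ z < 0 then (1 : ℝ) else 0) * exp (swapDelta S₁ S₂ z)
      * exp (-pairEnergy S₁ S₂ z) ∂(vol.prod vol) :=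
    integral_nonneg fun z =>
      mul_nonneg (mul_nonneg (by split_ifs <;> norm_num) (exp_pos _).le) (exp_pos _).le
  have hle := swap_downhill_tilted_integral_le vol h₁ h₂ hint
  constructor <;> linarith

/-- **THE SIGN-RULE TRIPWIRE HAS SECOND MOMENT AT MOST THE ACCEPTANCE** (unnormalised):
`∫ T(ΔS)² e^{−E} ≤ ∫ min(1, e^{−ΔS}) e^{−E}`. [ours] -/
theorem swap_signRuleStat_sq_integral_le_acceptance (h₁ : Measurable S₁) (h₂ : Measurable S₂)
    (hint : Integrable (fun z => exp (-pairEnergy S₁ S₂ z)) (vol.prod vol)) :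
    ∫ z, signRuleStat (swapDelta S₁ S₂ z) ^ 2 * exp (-pairEnergy S₁ S₂ z) ∂(vol.prod vol)
      ≤ ∫ z, min 1 (exp (-swapDelta S₁ S₂ z)) * exp (-pairEnergy S₁ S₂ z) ∂(vol.prod vol) := by
  have h2 := (swap_signRuleStat_sq_integral_le_two_mul vol h₁ h₂ hint).2
  rw [swap_acceptance_sign_rule vol h₁ h₂ hint]
  -- `∫ 𝟙[ΔS < 0]e^{−E} ≤ ∫ 𝟙[ΔS ≤ 0]e^{−E}`
  have hΔ := measurable_swapDelta h₁ h₂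
  have hwm : Measurable fun z : Ω × Ω => exp (-pairEnergy S₁ S₂ z) :=
    measurable_exp.comp (measurable_pairEnergy h₁ h₂).neg
  have hw0 : ∀ z : Ω × Ω, 0 ≤ exp (-pairEnergy S₁ S₂ z) := fun z => (exp_pos _).le
  have hlt_m : Measurable fun z : Ω × Ω => if swapDelta S₁ S₂ z < 0 then (1 : ℝ) else 0 :=
    Measurable.ite (measurableSet_lt hΔ measurable_const) measurable_const measurable_const
  have hle_m : Measurable fun z : Ω × Ω => if swapDelta S₁ S₂ z ≤ 0 then (1 : ℝ) else 0 :=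
    Measurable.ite (measurableSet_le hΔ measurable_const) measurable_const measurable_const
  have hI1 : Integrable (fun z => (if swapDelta S₁ S₂ z < 0 then (1 : ℝ) else 0) * exp (-pairEnergy S₁ S₂ z))
      (vol.prod vol) := by
    refine integrable_bdd_mul_weight hlt_m (C := 1) (fun z => ?_) hwm hw0 hint
    split_ifs <;> simp
  have hI0 : Integrable (fun z => (if swapDelta S₁ S₂ z ≤ 0 then (1 : ℝ) else 0) * exp (-pairEnergy S₁ S₂ z))
      (vol.prod vol) := by
    refine integrable_bdd_mul_weight hle_m (C := 1) (fun z => ?_) hwm hw0 hint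
    split_ifs <;> simp
  have hmono : ∫ z, (if swapDelta S₁ S₂ z < 0 then (1 : ℝ) else 0) * exp (-pairEnergy S₁ S₂ z) ∂(vol.prod vol)
      ≤ ∫ z, (if swapDelta S₁ S₂ z ≤ 0 then (1 : ℝ) else 0) * exp (-pairEnergy S₁ S₂ z) ∂(vol.prod vol) := by
    refine integral_mono hI1 hI0 fun z => mul_le_mul_of_nonneg_right ?_ (hw0 z)
    by_cases hz : swapDelta S₁ S₂ z < 0
    · rw [if_pos hz, if_pos hz.le]
    · rw [if_neg hz]; split_ifs <;> norm_num
  linarith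

/-- **Normalised form: `∫ T² dπ ≤ ∫ min(1, e^{−ΔS}) dπ`** under the joint Boltzmann law `π = e^{−E}(vol⊗vol)/Z`
(`Z > 0`).  With `∫ T dπ = 0` (`swap_signRuleStat_integral_boltzmann_eq_zero`): the single-proposal VARIANCE of
the sign-rule tripwire is at most the stationary mean swap acceptance. [ours] -/
theorem swap_signRuleStat_sq_boltzmann_le_acceptance (h₁ : Measurable S₁) (h₂ : Measurable S₂)
    (hint : Integrable (fun z => exp (-pairEnergy S₁ S₂ z)) (vol.prod vol))
    (hZ : 0 < HMC.partitionFn (vol.prod vol) (pairEnergy S₁ S₂)) :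
    ∫ z, signRuleStat (swapDelta S₁ S₂ z) ^ 2 ∂(HMC.boltzmann (vol.prod vol) (pairEnergy S₁ S₂))
      ≤ ∫ z, min 1 (exp (-swapDelta S₁ S₂ z)) ∂(HMC.boltzmann (vol.prod vol) (pairEnergy S₁ S₂)) := by
  have hE := measurable_pairEnergy h₁ h₂
  rw [HMC.integral_boltzmann hE hZ, HMC.integral_boltzmann hE hZ]
  refine mul_le_mul_of_nonneg_left ?_ (inv_nonneg.mpr hZ.le)
  simp_rw [mul_comm (exp (-pairEnergy S₁ S₂ _))]
  exact swap_signRuleStat_sq_integral_le_acceptance vol h₁ h₂ hint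

/-- **Lower half: `∫ 𝟙[ΔS < 0] dπ ≤ ∫ T² dπ`** under the joint Boltzmann law — downhill proposals alone
already give the statistic unit square. [ours] -/
theorem boltzmann_downhill_le_signRuleStat_sq (h₁ : Measurable S₁) (h₂ : Measurable S₂)
    (hint : Integrable (fun z => exp (-pairEnergy S₁ S₂ z)) (vol.prod vol))
    (hZ : 0 < HMC.partitionFn (vol.prod vol) (pairEnergy S₁ S₂)) :
    ∫ z, (if swapDelta S₁ S₂ z < 0 then (1 : ℝ) else 0) ∂(HMC.boltzmann (vol.prod vol) (pairEnergy S₁ S₂))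
      ≤ ∫ z, signRuleStat (swapDelta S₁ S₂ z) ^ 2 ∂(HMC.boltzmann (vol.prod vol) (pairEnergy S₁ S₂)) := by
  have hE := measurable_pairEnergy h₁ h₂
  rw [HMC.integral_boltzmann hE hZ, HMC.integral_boltzmann hE hZ]
  refine mul_le_mul_of_nonneg_left ?_ (inv_nonneg.mpr hZ.le)
  simp_rw [mul_comm (exp (-pairEnergy S₁ S₂ _))]
  exact (swap_signRuleStat_sq_integral_le_two_mul vol h₁ h₂ hint).1

end Summit.Ventures.LatticeQCDFlow.Exactness

end
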